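import Summits.ValiantsHypothesis.ValiantsHypothesis.Theorems.LacunarySymmetroidMatrixDescartesCensusChamberNewton

/-!
# `MatrixDescartes` census — TRANSPORT helpers for chamber-uniform margins (log of gap products, order and AM–GM moves)

HONEST FRAMING.  Object-search cell `pub-symmetroid`, door-A target `DoorA26 := PosRootLawAt 2 6 19`
(stmt-ValiantsHypothesis-19979; OPEN, typed, never asserted), crux `Theses.LacunarySymmetroid.MatrixDescartes`
(stmt-ValiantsHypothesis-18050).  In a chamber-uniform `V = 20` certificate (theory g6 slope form + the val-sym-door-p2
«NFLOW» transport, NFLOW-METHOD note on the item) the margin `F(d) = Σ_t μ_t log W_t(d) − c₀ log 2`, `W_t = Π_{s≠t} |E_t − E_s|`, is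
shown positive for a SYMBOLIC exponent vector by finitely many moves, each resting on a LINEAR inequality between difference forms
that holds on the chamber: an ORDER move `v ≤ v' ⇒ log v ≤ log v'` and an AM–GM SPLIT `v + v' ≤ v'' ⇒ log 2 + (log v + log v')/2 ≤ log v''`,
plus `1 ≤ v ⇒ 0 ≤ log v` for integer gaps.  This file supplies these moves and the expansion of `log W_t` into a sum of logs of
gaps along a chamber order, once:

* `log_gapProd_eq_sum` — `log Π_{s ≠ t} |E_t − E_s| = Σ_{s ≠ t} log |E_t − E_s|` for an injective position map `E`;
* `log_normalised_eq` — `log (|c| · Π_{s≠t} |E_t − E_s|) = log |c| + Σ_{s≠t} log |E_t − E_s|` (`c ≠ 0`), the bridge from the atoms of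
  `Census.chamber_newton_cone_log` to `log |c_t|` and gap logs;
* `log_le_log_of_le_pos`, `log_two_add_half_le` (AM–GM split), `log_nonneg_of_one_le_cast` — the three moves.

Pure bookkeeping; nothing bears on any census row, on `DoorA26` (OPEN), on the crux, or on `VP ≠ VNP`.

[folklore] Elementary real analysis.
-/

-- `Summit.ValiantsHypothesis.ValiantsHypothesis.…` repeats a component by the D-0017 layout
-- (single-conjunct summit), which the `dupNamespace` linter flags; the name is mandated.
set_option linter.dupNamespace false

namespace Summit.ValiantsHypothesis.ValiantsHypothesis.Theorems.LacunarySymmetroidMatrixDescartes.Census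

open Finset
open scoped BigOperators

/-- `log` of a gap product along an injective position map is the sum of the logs of the gaps. [folklore] -/
theorem log_gapProd_eq_sum {n : ℕ} (E : Fin n → ℕ) (hE : Function.Injective E) (t : Fin n) :
    Real.log (∏ s ∈ univ.erase t, |((E t : ℕ) : ℝ) - ((E s : ℕ) : ℝ)|)
      = ∑ s ∈ univ.erase t, Real.log |((E t : ℕ) : ℝ) - ((E s : ℕ) : ℝ)| := by
  apply Real.log_prod
  intro s hs h0
  have hst : s ≠ t := ne_of_mem_erase hs
  have : (E t : ℝ) = (E s : ℝ) := by
    have := abs_eq_zero.mp h0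
    linarith
  exact hst (hE (by exact_mod_cast this.symm))

/-- The Newton-normalised atom splits: `log (|c| · Π_{s≠t} |E_t − E_s|) = log |c| + Σ_{s≠t} log |E_t − E_s|`. [folklore] -/
theorem log_normalised_eq {n : ℕ} (E : Fin n → ℕ) (hE : Function.Injective E) (t : Fin n) (c : ℝ) (hc : c ≠ 0) :
    Real.log (|c| * ∏ s ∈ univ.erase t, |((E t : ℕ) : ℝ) - ((E s : ℕ) : ℝ)|)
      = Real.log |c| + ∑ s ∈ univ.erase t, Real.log |((E t : ℕ) : ℝ) - ((E s : ℕ) : ℝ)| := by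
  have hprod : (∏ s ∈ univ.erase t, |((E t : ℕ) : ℝ) - ((E s : ℕ) : ℝ)|) ≠ 0 := by
    rw [prod_ne_zero_iff]
    intro s hs h0
    have hst : s ≠ t := ne_of_mem_erase hs
    have : (E t : ℝ) = (E s : ℝ) := by
      have := abs_eq_zero.mp h0
      linarith
    exact hst (hE (by exact_mod_cast this.symm))
  rw [Real.log_mul (abs_ne_zero.mpr hc) hprod, log_gapProd_eq_sum E hE t]

/-- ORDER move: `0 < v ≤ v'` gives `log v ≤ log v'`. [folklore] -/
theorem log_le_log_of_le_pos {v v' : ℝ} (hv : 0 < v) (h : v ≤ v') : Real.log v ≤ Real.log v' :=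
  Real.log_le_log hv h

/-- AM–GM SPLIT move: `0 < v`, `0 < v'`, `v + v' ≤ v''` give `log 2 + (log v + log v')/2 ≤ log v''`
(since `2√(v v') ≤ v + v'`). [folklore] -/
theorem log_two_add_half_le {v v' v'' : ℝ} (hv : 0 < v) (hv' : 0 < v') (h : v + v' ≤ v'') :
    Real.log 2 + (Real.log v + Real.log v') / 2 ≤ Real.log v'' := by
  have hv'' : 0 < v'' := by linarith
  -- (2 √(v v'))² = 4 v v' ≤ (v + v')² ≤ v''²
  have hsq : (2 * Real.sqrt (v * v')) ^ 2 ≤ v'' ^ 2 := by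
    have h1 : (2 * Real.sqrt (v * v')) ^ 2 = 4 * (v * v') := by
      rw [mul_pow, Real.sq_sqrt (by positivity)]; ring
    rw [h1]
    nlinarith [sq_nonneg (v - v'), h, hv, hv']
  have hle : 2 * Real.sqrt (v * v') ≤ v'' := by
    have h2 : 0 ≤ 2 * Real.sqrt (v * v') := by positivity
    nlinarith [hsq, h2, hv'']
  have hpos : 0 < 2 * Real.sqrt (v * v') := by positivity
  have hlog := Real.log_le_log hpos hle
  rw [Real.log_mul (by norm_num) (Real.sqrt_ne_zero'.mpr (by positivity)), Real.log_sqrt (by positivity : (0:ℝ) ≤ v * v'),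
    Real.log_mul hv.ne' hv'.ne'] at hlog
  linarith

/-- INTEGER move: a natural-number gap `1 ≤ v` has `0 ≤ log v`. [folklore] -/
theorem log_nonneg_of_one_le_cast {v : ℕ} (h : 1 ≤ v) : 0 ≤ Real.log (v : ℝ) :=
  Real.log_nonneg (by exact_mod_cast h)

/-- INTEGER move, difference form: for naturals `a < b`, `0 ≤ log (b − a)` (real subtraction). [folklore] -/
theorem log_sub_cast_nonneg {a b : ℕ} (h : a < b) : 0 ≤ Real.log ((b : ℝ) - (a : ℝ)) := by
  apply Real.log_nonneg
  have : (a : ℝ) + 1 ≤ (b : ℝ) := by exact_mod_cast h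
  linarith

end Summit.ValiantsHypothesis.ValiantsHypothesis.Theorems.LacunarySymmetroidMatrixDescartes.Census
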